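import Mathlib
import Summits.Ventures.HodgeRepro2.Tier7.Target
import Summits.Ventures.HodgeRepro2.Tier7.Common.Datum
import Summits.Ventures.HodgeRepro2.Tier7.Lit3
import Summits.Ventures.HodgeRepro2.Tier7.Lit3Dict
import Summits.Ventures.HodgeRepro2.Tier7.Line1.Defs
import Summits.Ventures.HodgeRepro2.Tier7.Line1.WedgeNonzero
import Summits.Ventures.HodgeRepro2.Tier7.Line1.WedgePencil

/-!
# Tier7/Line1/WedgePencilDict — `PencilShadow` from the printed Proposition X.9 consumed BY NAME (t7-L1-p4)

Cell pub-hodge-repro2, Tier 7, LINE L1, prover t7-L1-p4; census item 9 of proofs/t7/L1/L1.1-p4.md §4. Sorry-free.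
Imports: Mathlib, `Tier7.Target`, `Tier7.Common.Datum`, `Tier7.Lit3` (t7-lit-3: `Hyp.Beauville1996_X_9`), `Tier7.Lit3Dict`
(t7-lit-3: `CurveData`, `SurfaceShadow.beauvilleShape`, `wedge10`), `Tier7.Line1.Defs`, `Tier7.Line1.WedgeNonzero`,
`Tier7.Line1.WedgePencil` (`PencilShadow`, the Pencil Theorem).

WHAT THIS DOES. `WedgePencil.lean` displays the Castelnuovo–de Franchis shadow `PencilShadow S` with its field
`pencil_max` = «printed CdF + uniqueness of the pencil through a non-zero 1-form». Here the printed half is CONSUMED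
BY NAME: from the real curves `C : CurveData S` (lit-3's dictionary), the printed Proposition X.9 read on them
(`Hyp.Beauville1996_X_9 (S.beauvilleShape C)`) and the three remaining facts about pull-backs (`PencilFacts C`:
graded commutativity, `Ω²_B = 0`, and Lemma U in the form «two pencils through one non-zero form have mutually
isotropic pull-back spaces»), we BUILD a `PencilShadow S` (`pencilShadow_of_X9`), whose `pencil a` is the span of `a`
and of every pull-back space `p^*H⁰(B, Ω¹_B)` containing `a`. So the Pencil Theorem and the equivalence
`WedgeNonzero D ↔ no Hecke-stable isotropic subspace carries omega 0 ⊔ omega 1` hold with X.9 consumed by name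
(`wedgeNonzero_iff_no_stable_isotropic_of_X9`), and the ONLY field without a printed sentence is `pull_unique`
(Lemma U, proofs/t7/L1/L1.1-p4.md §2.2 — nearest print Catanese LNM 1938 Thm 4.3 (2), route/SOURCES.md §S16).

STATUS (unchanged from WedgePencil.lean): bookkeeping for the record — L1.1 is an input implied by (P), not a residual;
no printed input short of (P) closes it; this module pins down which printed sentences enter its geometric reading.
§8(d): uses an L-value-free non-vanishing device: NO.
-/

namespace Summit.Ventures.HodgeRepro2.Tier7.Line1

open Summit.Ventures.HodgeRepro2.Tier7

noncomputable section

variable {HX : Type} [Ring HX] [Algebra ℂ HX] {G : Type} [Group G] [MulAction G HX]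

/-! ## 1. The pull-back spaces and the facts about them that the dictionary does not carry -/

/-- the pull-back space `p^*H⁰(B, Ω¹_B) ⊂ H^{1,0}(X)` of a connected-fibre surjection `p : X → B`, as a subspace of
the cohomology ring -/
def pullSpace {S : SurfaceShadow HX G} (C : CurveData S) (B : C.Curve) (p : C.Fibration B) : Submodule ℂ HX :=
  (LinearMap.range (C.pull B p)).map S.H10.subtype

/-- membership in a pull-back space: `x = p^*α` for some `α ∈ H⁰(B, Ω¹_B)` -/
theorem mem_pullSpace {S : SurfaceShadow HX G} (C : CurveData S) (B : C.Curve) (p : C.Fibration B) (x : HX) :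
    x ∈ pullSpace C B p ↔ ∃ α : C.OmegaB B, (C.pull B p α : HX) = x := by
  unfold pullSpace
  constructor
  · rintro ⟨y, ⟨α, rfl⟩, rfl⟩
    exact ⟨α, rfl⟩
  · rintro ⟨α, rfl⟩
    exact ⟨C.pull B p α, ⟨α, rfl⟩, rfl⟩

/-- a pull-back space consists of holomorphic 1-forms -/
theorem pullSpace_le {S : SurfaceShadow HX G} (C : CurveData S) (B : C.Curve) (p : C.Fibration B) :
    pullSpace C B p ≤ S.H10 := by
  rintro _ ⟨y, _, rfl⟩
  exact y.2

/-- The facts about the curves of `X` that the dictionary `CurveData` does not carry — each a printed fact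
about the real surface, except `pull_unique`, which is Lemma U (paper; proofs/t7/L1/L1.1-p4.md §2.2):
* `anticomm`: graded commutativity of the cup product for classes of degree 1 (folklore, Hodge / de Rham theory);
* `pull_isotropic`: `p^*α ∧ p^*β = p^*(α ∧ β) = 0` since `Ω²_B = 0` on a curve (folklore);
* `pull_unique`: if one NON-ZERO 1-form is pulled back from two connected-fibre surjections `p : X → B` and
  `p' : X → B'`, then every pull-back along `p` wedges to zero with every pull-back along `p'` (Lemma U: `p` and `p'`
  are the same fibration, so this is `pull_isotropic`; NOT located in print as a sentence; nearest: Catanese LNM 1938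
  Thm 4.3 (2)). The case `B' = B`, `p' = p` is `pull_isotropic` again. -/
structure PencilFacts {S : SurfaceShadow HX G} (C : CurveData S) where
  /-- graded commutativity of 1-forms -/
  anticomm : ∀ a ∈ S.H10, ∀ b ∈ S.H10, a * b = -(b * a)
  /-- `Ω²_B = 0`: pull-backs along one fibration wedge to zero -/
  pull_isotropic : ∀ (B : C.Curve) (p : C.Fibration B) (α β : C.OmegaB B),
    (C.pull B p α : HX) * C.pull B p β = 0
  /-- Lemma U: two fibrations through one non-zero 1-form have mutually isotropic pull-back spaces -/
  pull_unique : ∀ (B : C.Curve) (p : C.Fibration B) (α : C.OmegaB B) (B' : C.Curve) (p' : C.Fibration B')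
    (α' : C.OmegaB B'), (C.pull B p α : HX) = C.pull B' p' α' → (C.pull B p α : HX) ≠ 0 →
    ∀ (β : C.OmegaB B) (β' : C.OmegaB B'), (C.pull B p β : HX) * C.pull B' p' β' = 0

/-! ## 2. The pencil through a 1-form, from the curves -/

/-- the generators of the pencil through `a`: `a` itself and every pull-back space containing `a` -/
def pencilGens {S : SurfaceShadow HX G} (C : CurveData S) (a : HX) : Set HX :=
  {a} ∪ ⋃ (B : C.Curve) (p : C.Fibration B) (_ : a ∈ pullSpace C B p), (pullSpace C B p : Set HX)

/-- the pencil through `a`: the span of its generators -/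
def pencilOf {S : SurfaceShadow HX G} (C : CurveData S) (a : HX) : Submodule ℂ HX :=
  Submodule.span ℂ (pencilGens C a)

/-- the generators of the pencil through `a`: `a` itself, or a vector of a pull-back space containing `a` -/
theorem mem_pencilGens_iff {S : SurfaceShadow HX G} (C : CurveData S) (a x : HX) :
    x ∈ pencilGens C a ↔ x = a ∨ ∃ (B : C.Curve) (p : C.Fibration B), a ∈ pullSpace C B p ∧ x ∈ pullSpace C B p := by
  unfold pencilGens
  simp only [Set.mem_union, Set.mem_singleton_iff, Set.mem_iUnion, SetLike.mem_coe, exists_prop]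

/-- `a` lies in its own pencil -/
theorem self_mem_pencilOf {S : SurfaceShadow HX G} (C : CurveData S) (a : HX) : a ∈ pencilOf C a :=
  Submodule.subset_span ((mem_pencilGens_iff C a a).mpr (Or.inl rfl))

/-- a pull-back space containing `a` lies in the pencil through `a` -/
theorem pullSpace_le_pencilOf {S : SurfaceShadow HX G} (C : CurveData S) {a : HX} {B : C.Curve}
    {p : C.Fibration B} (ha : a ∈ pullSpace C B p) : pullSpace C B p ≤ pencilOf C a := by
  intro x hx
  exact Submodule.subset_span ((mem_pencilGens_iff C a x).mpr (Or.inr ⟨B, p, ha, hx⟩))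

/-- the pencil through a holomorphic 1-form consists of holomorphic 1-forms -/
theorem pencilOf_le {S : SurfaceShadow HX G} (C : CurveData S) {a : HX} (ha : a ∈ S.H10) :
    pencilOf C a ≤ S.H10 := by
  apply Submodule.span_le.mpr
  intro x hx
  rcases (mem_pencilGens_iff C a x).mp hx with rfl | ⟨B, p, _, hx⟩
  · exact ha
  · exact pullSpace_le C B p hx

/-- the generators of the pencil through `a ∈ H^{1,0}` have pairwise vanishing products (graded commutativity for
`a ∧ a`, `Ω²_B = 0` for `a` against its own pencils, Lemma U for two pencils through `a`) -/
theorem pencilGens_mul_eq_zero {S : SurfaceShadow HX G} {C : CurveData S} (F : PencilFacts C) {a : HX}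
    (ha : a ∈ S.H10) (h0 : a ≠ 0) : ∀ x ∈ pencilGens C a, ∀ y ∈ pencilGens C a, x * y = 0 := by
  intro x hx y hy
  rcases (mem_pencilGens_iff C a x).mp hx with hxa | ⟨B, p, haB, hxB⟩ <;>
    rcases (mem_pencilGens_iff C a y).mp hy with hya | ⟨B', p', haB', hyB'⟩
  · -- `a * a = 0` (graded commutativity, characteristic 0)
    rw [hxa, hya]
    have h := F.anticomm a ha a ha
    have h2 : (2 : ℂ) • (a * a) = 0 := by
      rw [two_smul]
      nth_rewrite 1 [h]
      exact neg_add_cancel _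
    exact (smul_eq_zero.mp h2).resolve_left two_ne_zero
  · -- `a * y` with `a, y` in one pull-back space
    rw [hxa]
    obtain ⟨α, hα⟩ := (mem_pullSpace C B' p' a).mp haB'
    obtain ⟨β, hβ⟩ := (mem_pullSpace C B' p' y).mp hyB'
    rw [← hα, ← hβ]
    exact F.pull_isotropic B' p' α β
  · -- `x * a` with `x, a` in one pull-back space
    rw [hya]
    obtain ⟨α, hα⟩ := (mem_pullSpace C B p x).mp hxB
    obtain ⟨β, hβ⟩ := (mem_pullSpace C B p a).mp haB
    rw [← hα, ← hβ]
    exact F.pull_isotropic B p α β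
  · -- `x * y`, `x` and `y` in two pull-back spaces both containing `a ≠ 0`: Lemma U
    obtain ⟨α, hα⟩ := (mem_pullSpace C B p a).mp haB
    obtain ⟨α', hα'⟩ := (mem_pullSpace C B' p' a).mp haB'
    obtain ⟨β, hβ⟩ := (mem_pullSpace C B p x).mp hxB
    obtain ⟨β', hβ'⟩ := (mem_pullSpace C B' p' y).mp hyB'
    rw [← hβ, ← hβ']
    exact F.pull_unique B p α B' p' α' (hα.trans hα'.symm) (by rw [hα]; exact h0) β β'

/-- the pencil through `a ≠ 0` in `H^{1,0}` is isotropic -/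
theorem wedgeIsotropic_pencilOf {S : SurfaceShadow HX G} {C : CurveData S} (F : PencilFacts C) {a : HX}
    (ha : a ∈ S.H10) (h0 : a ≠ 0) : WedgeIsotropic (pencilOf C a) :=
  wedgeIsotropic_span (pencilGens_mul_eq_zero F ha h0)

/-- linear independence of two 1-forms from «`q` is not a multiple of `a ≠ 0`» (in the subtype `H10`) -/
theorem linearIndependent_pair_of_not_smul {S : SurfaceShadow HX G} {a q : HX} (ha : a ∈ S.H10) (hq : q ∈ S.H10)
    (h0 : a ≠ 0) (hqa : ¬ ∃ c : ℂ, q = c • a) :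
    LinearIndependent ℂ ![(⟨a, ha⟩ : S.H10), ⟨q, hq⟩] := by
  rw [LinearIndependent.pair_iff]
  intro s t hst
  have hst' : s • a + t • q = 0 := by
    have := congrArg Subtype.val hst
    simpa using this
  by_cases ht : t = 0
  · subst ht
    rw [zero_smul, add_zero] at hst'
    exact ⟨(smul_eq_zero.mp hst').resolve_right h0, rfl⟩
  · exfalso
    apply hqa
    refine ⟨-(s / t), ?_⟩
    have : t • q = -(s • a) := eq_neg_of_add_eq_zero_right hst'
    calc q = t⁻¹ • (t • q) := by rw [smul_smul, inv_mul_cancel₀ ht, one_smul]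
      _ = t⁻¹ • (-(s • a)) := by rw [this]
      _ = -(s / t) • a := by rw [smul_neg, smul_smul, neg_smul, div_eq_inv_mul]

/-- CASTELNUOVO–DE FRANCHIS BY NAME: every isotropic subspace of `H^{1,0}` containing `a ≠ 0` lies in the pencil
through `a`. Proof: a vector `q` of it is either a multiple of `a` (in the span), or independent of `a` with
`a ∧ q = 0`, and then Proposition X.9 (read through lit-3's dictionary) pulls `a` and `q` back from one fibration,
whose pull-back space contains `a` and hence lies in `pencilOf C a`. -/
theorem le_pencilOf_of_isotropic {S : SurfaceShadow HX G} (C : CurveData S)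
    (hX9 : Hyp.Beauville1996_X_9 (S.beauvilleShape C)) {a : HX} (ha : a ∈ S.H10) (h0 : a ≠ 0)
    (Q : Submodule ℂ HX) (hQ : Q ≤ S.H10) (hiso : WedgeIsotropic Q) (haQ : a ∈ Q) : Q ≤ pencilOf C a := by
  intro q hq
  by_cases hqa : ∃ c : ℂ, q = c • a
  · obtain ⟨c, rfl⟩ := hqa
    exact Submodule.smul_mem _ c (self_mem_pencilOf C a)
  · have hli := linearIndependent_pair_of_not_smul ha (hQ hq) h0 hqa
    have hzero : S.wedge10 ⟨a, ha⟩ ⟨q, hQ hq⟩ = 0 := by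
      rw [SurfaceShadow.wedge10_apply]
      exact hiso a haQ q hq
    obtain ⟨B, _, p, α₁, α₂, h₁, h₂⟩ := hX9 ⟨a, ha⟩ ⟨q, hQ hq⟩ hli hzero
    have haB : a ∈ pullSpace C B p :=
      (mem_pullSpace C B p a).mpr ⟨α₁, (congrArg Subtype.val h₁).symm⟩
    have hqB : q ∈ pullSpace C B p :=
      (mem_pullSpace C B p q).mpr ⟨α₂, (congrArg Subtype.val h₂).symm⟩
    exact pullSpace_le_pencilOf C haB hqB

/-! ## 3. The Castelnuovo–de Franchis shadow from the curves, X.9 by name, and the three pull-back facts -/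

/-- `PencilShadow` from the real curves, the printed Proposition X.9 consumed by name, and `PencilFacts`. -/
def pencilShadow_of_X9 {S : SurfaceShadow HX G} (C : CurveData S)
    (hX9 : Hyp.Beauville1996_X_9 (S.beauvilleShape C)) (F : PencilFacts C) : PencilShadow S where
  anticomm := F.anticomm
  pencil := pencilOf C
  pencil_le := fun _ ha => pencilOf_le C ha
  pencil_isotropic := fun _ ha h0 => wedgeIsotropic_pencilOf F ha h0
  mem_pencil := fun a _ => self_mem_pencilOf C a
  pencil_max := fun _ ha h0 Q hQ hiso haQ => le_pencilOf_of_isotropic C hX9 ha h0 Q hQ hiso haQ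

/-! ## 4. The pencil reading of L1.1 with Proposition X.9 consumed by name -/

section Datum

variable {K : Type} [Field K] [NumberField K] {E' : Type} [Field E'] [NumberField E']
  {V : Type} [AddCommGroup V] [Module E' V] (D : PeriodDatum K E' V HX G)

/-- THE PENCIL THEOREM with X.9 by name: if every Hecke translate of `f^*Ω_s` vanishes, one Hecke-stable isotropic
subspace of `H^{1,0}` (a `G`-equivariant irrational pencil) contains both `omega 0` and `omega 1`. -/
theorem exists_stable_isotropic_of_forall_wedge_eq_zero_of_X9 (C : CurveData D.S)
    (hX9 : Hyp.Beauville1996_X_9 (D.S.beauvilleShape C)) (F : PencilFacts C)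
    (h0 : ∀ g : Fin 4 → G, D.fOmegaS g = 0) :
    ∃ P : Submodule ℂ HX, P ≤ D.S.H10 ∧ HeckeStable G P ∧ WedgeIsotropic P ∧
      D.omega 0 ≤ P ∧ D.omega 1 ≤ P :=
  exists_stable_isotropic_of_forall_wedge_eq_zero D (pencilShadow_of_X9 C hX9 F) h0

/-- L1.1 with X.9 by name: `WedgeNonzero D ↔ no Hecke-stable isotropic subspace of H^{1,0} carries both theta
summands` (the geometric name of the non-vanishing; equivalent to it, implied by (P), not a printed input). -/
theorem wedgeNonzero_iff_no_stable_isotropic_of_X9 (C : CurveData D.S)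
    (hX9 : Hyp.Beauville1996_X_9 (D.S.beauvilleShape C)) (F : PencilFacts C) :
    WedgeNonzero D ↔ ∀ P : Submodule ℂ HX, P ≤ D.S.H10 → HeckeStable G P → WedgeIsotropic P →
      ¬ (D.omega 0 ≤ P ∧ D.omega 1 ≤ P) :=
  wedgeNonzero_iff_no_stable_isotropic D (pencilShadow_of_X9 C hX9 F)

/-- the same for L1.1′ and the corners `2, 3` -/
theorem wedgeNonzeroBar_iff_no_stable_isotropic_of_X9 (C : CurveData D.S)
    (hX9 : Hyp.Beauville1996_X_9 (D.S.beauvilleShape C)) (F : PencilFacts C) :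
    WedgeNonzeroBar D ↔ ∀ P : Submodule ℂ HX, P ≤ D.S.H10 → HeckeStable G P → WedgeIsotropic P →
      ¬ (D.omega 2 ≤ P ∧ D.omega 3 ≤ P) :=
  wedgeNonzeroBar_iff_no_stable_isotropic D (pencilShadow_of_X9 C hX9 F)

end Datum

end

end Summit.Ventures.HodgeRepro2.Tier7.Line1
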